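import Literature.NumberTheory.GaloisCohomology.TateEulerCharacteristicPrimeToPBaseInputs
import Literature.RepresentationTheory.FiniteGroups.MatrixTwistFixedVectors
import Mathlib.LinearAlgebra.Dimension.Free
import HarnessLib

/-!
# Tate's global Euler characteristic at a totally complex field: the prime-to-`p` base case
# from the equivariant identity (Milne ADT I Thm. 5.1, proof; NSW (8.7.4))

Topic `NumberTheory/GaloisCohomology`; namespace `Literature.NumberTheory.GaloisCohomology`.  Theorems
only; no definition, no named fact, no `sorry`, no instance, no notation.

`K` totally complex, `S ⊇ S_p` finite, `G_S = G_{K,S}`, `ρ₀ ≅ μ_p` (`MuCarrier K p`), `W` open normal in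
`G_S` fixing `μ_p`, `U ⊇ W` with `p ∤ [U : W]` (e.g. `U = π⁻¹(C)`, `#C` prime to `p`), `σ` a
representation of `G_S ⧸ W` on a finite `M` with `pM = 0`, `Δ := ↥U ⧸ (W ∩ U)`,
`𝓗ⁿ(μ_p) := Hⁿ(↥U, Maps(Δ, μ_p))` with its right `Δ`-action (`coindOpenHRep`).

* **`euler_restrict_of_coindMuEuler`** (and `…_of_module`): IF for every `ℤ`-valued invariant `ψ` of
  `ℤ[Δ]`-modules additive on short exact sequences of finite `p`-torsion modules
  `ψ(𝓗⁰(μ_p)) + ψ(𝓗²(μ_p)) + r • ψ(𝔽_p[Δ]) = ψ(𝓗¹(μ_p))` (hypothesis `hB6b` — the equivariant Kummer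
  computation, lane brick B8-arith), THEN
  `v_p #H⁰(U, M) − v_p #H¹(U, M) + v_p #H²(U, M) + r · v_p #M = 0`
  in the spelling of the hypothesis `hbase` of
  `TateGlobalEulerCharacteristicTCOfBase.tateGlobalEulerPoincareCharacteristic_of_isTotallyComplex_of_base`;
* **`baseK_of_coindMuEuler`**: the `hbase` instance `U = π⁻¹(C)`, `r = [G_S : U] · r₂(K)`.

Proof: the generic computation `ContinuousCohomologyTwistEulerCharacteristic.euler_characteristic_of_fixedCount`
on the compact group `↥U` at the matrices `coordMatrix` of `M ⊗ μ_p^{⊗-1}` (`MatrixTwistFixedVectors`),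
`hB6b` read at `ψ := v_p #{Δ-fixed vectors of X ⊗ M′}` (`additive_padicValNat_fixedVectors`,
`natCard_fixedVectors_permQuot`), and the finiteness inputs of `TateEulerCharacteristicPrimeToPBaseInputs`.

Lane «TATE-EPC-TC» (cell `bsd-eis`, stmt-BirchSwinnertonDyer-19032), brick B8-alg (E-final).  HONEST
FRAMING: conditional on `hB6b`; no case of BSD is proved, and Tate's theorem at `K` follows only once
`hB6b` is supplied (B8-arith) and fed to `…_of_isTotallyComplex_of_base`.

## References
* J. S. Milne, *Arithmetic Duality Theorems*, 2nd ed. (2006), I Thm. 5.1 (proof, p. 69). [MilneADT2006]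
* J. Neukirch, A. Schmidt, K. Wingberg, *Cohomology of Number Fields*, 2nd ed. (2008), (8.7.4). [NeukirchSchmidtWingberg2008]
-/

noncomputable section

open CategoryTheory Function
open scoped Topology

namespace Literature.NumberTheory.GaloisCohomology

open Literature.NumberTheory.GaloisRepresentations
open Literature.NumberTheory.GaloisRepresentations.DiscreteGaloisModule (mu MuCarrier)
open Literature.RepresentationTheory.FiniteGroups
open _root_.TopRep _root_.ContRepresentation _root_.ContinuousCohomology
open NumberField Field IsDedekindDomain
open scoped NumberField Pointwise

variable {K : Type} [Field K] [NumberField K]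

/-! ## §3 The base case `hbase` from the equivariant Euler-characteristic identity -/

/-- **The prime-to-`p` base case of Tate's formula for one pair `W ≤ U ≤ G_{K,S}`, from the
equivariant identity.**  `K` totally complex, `S ⊇ S_p` finite, `ρ₀ ≅ μ_p`, `W` open normal in `G_S`
fixing `μ_p`, `U ⊇ W` with `p ∤ [U : W]`, `σ` a representation of `G_S ⧸ W` on a finite `M` with
`pM = 0`.  HYPOTHESIS `hB6b` (the equivariant Kummer computation, lane brick B8-arith): for every
`ℤ`-valued invariant `ψ` of `ℤ[Δ]`-modules (`Δ = ↥U ⧸ (W ∩ U)`) additive on short exact sequences of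
finite `p`-torsion modules, `ψ(𝓗⁰(μ_p)) + ψ(𝓗²(μ_p)) + r • ψ(𝔽_p[Δ]) = ψ(𝓗¹(μ_p))` where
`𝓗ⁿ(μ_p) = Hⁿ(↥U, Maps(Δ, μ_p))` with its right `Δ`-action (`coindOpenHRep`).  CONCLUSION: the `hbase`
line of `TateGlobalEulerCharacteristicTCOfBase.tateGlobalEulerPoincareCharacteristic_of_isTotallyComplex_of_base`
with exponent `r`: `v_p #H⁰(U, M) − v_p #H¹(U, M) + v_p #H²(U, M) + r · v_p #M = 0`.
Proof: `ContinuousCohomologyTwistEulerCharacteristic.euler_characteristic_of_fixedCount` at the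
matrices `coordMatrix` of `M ⊗ μ_p^{⊗-1}` (`MatrixTwistFixedVectors`), `hB6b` read at
`ψ := v_p #{fixed vectors}` (`additive_padicValNat_fixedVectors`, `natCard_fixedVectors_permQuot`), and §2.
[cite: MilneADT2006, I Thm. 5.1 (proof)] [cite: NeukirchSchmidtWingberg2008, (8.7.4)] -/
theorem euler_restrict_of_coindMuEuler_of_module [IsTotallyComplex K]
    (S : Set (HeightOneSpectrum (𝓞 K))) (hS : S.Finite) (p : ℕ) [Fact p.Prime]
    (hSp : ∀ v : HeightOneSpectrum (𝓞 K), ((p : ℕ) : 𝓞 K) ∈ v.asIdeal → v ∈ S)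
    (ρ₀ : ContinuousRep (GaloisGroupUnramifiedOutside K S) ℤ (MuCarrier K p))
    (hρ₀ : ∀ (τ : absoluteGaloisGroup K) (v : MuCarrier K p), ρ₀ (toUnramifiedQuot K S τ) v = mu K p τ v)
    (W U : Subgroup (GaloisGroupUnramifiedOutside K S)) [W.Normal] [DiscreteTopology (GaloisGroupUnramifiedOutside K S ⧸ W)]
    (hWU : W ≤ U) (hWo : IsOpen (W : Set (GaloisGroupUnramifiedOutside K S)))
    (hWfix : ∀ g ∈ W, ∀ v : MuCarrier K p, ρ₀ g v = v) [CompactSpace ↥U]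
    (hW' : IsOpen ((W.subgroupOf U : Subgroup ↥U) : Set ↥U))
    (hcop : ¬ p ∣ Nat.card (↥U ⧸ W.subgroupOf U))
    (M : Type) [AddCommGroup M] [TopologicalSpace M] [DiscreteTopology M] [Finite M] [Module (ZMod p) M]
    (σ : Representation ℤ (GaloisGroupUnramifiedOutside K S ⧸ W) M) (r : ℕ)
    (hB6b : ∀ (ψ : ∀ ⦃X : Type⦄ [AddCommGroup X] [Module ℤ X],
        Representation ℤ (↥U ⧸ W.subgroupOf U) X → ℤ),
      (∀ ⦃X Y Z : Type⦄ [AddCommGroup X] [Module ℤ X] [AddCommGroup Y] [Module ℤ Y]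
        [AddCommGroup Z] [Module ℤ Z] (ρX : Representation ℤ (↥U ⧸ W.subgroupOf U) X)
        (ρY : Representation ℤ (↥U ⧸ W.subgroupOf U) Y) (ρZ : Representation ℤ (↥U ⧸ W.subgroupOf U) Z)
        (f : X →ₗ[ℤ] Y) (g : Y →ₗ[ℤ] Z),
        (∀ s x, f (ρX s x) = ρY s (f x)) → (∀ s y, g (ρY s y) = ρZ s (g y)) →
        Injective f → Surjective g → LinearMap.range f = LinearMap.ker g → Finite Y →
        (∀ y : Y, (p : ℤ) • y = 0) → ψ ρY = ψ ρX + ψ ρZ) →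
      ψ ((ρ₀.restrict (subgroupIncl U)).coindOpenHRep (W.subgroupOf U) hW' 0) +
          ψ ((ρ₀.restrict (subgroupIncl U)).coindOpenHRep (W.subgroupOf U) hW' 2) +
          r • ψ ((Representation.ofMulAction ℤ (↥U ⧸ W.subgroupOf U) (↥U ⧸ W.subgroupOf U)).quotient
            ((p : ℤ) • ⊤) (StableLatticeReduction.smul_top_le_comap _ (p : ℤ))) =
        ψ ((ρ₀.restrict (subgroupIncl U)).coindOpenHRep (W.subgroupOf U) hW' 1)) :
    ((padicValNat p (Nat.card (continuousCohomology 0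
        (((ContinuousRep.ofDiscrete σ).restrict (ContinuousMonoidHom.quotientMk W)).restrict
          (subgroupIncl U)).toTopRep)) : ℤ) -
        padicValNat p (Nat.card (continuousCohomology 1
          (((ContinuousRep.ofDiscrete σ).restrict (ContinuousMonoidHom.quotientMk W)).restrict
            (subgroupIncl U)).toTopRep)) +
        padicValNat p (Nat.card (continuousCohomology 2
          (((ContinuousRep.ofDiscrete σ).restrict (ContinuousMonoidHom.quotientMk W)).restrict
            (subgroupIncl U)).toTopRep)) +
      (r : ℕ) * padicValNat p (Nat.card M)) = 0 := by
  classical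
  haveI : TotallyDisconnectedSpace (GaloisGroupUnramifiedOutside K S) :=
    Literature.GroupTheory.ProfiniteSubquotients.totallyDisconnectedSpace_quotient
      (ramificationSubgroup K S) (ramificationSubgroup_isClosed K S)
  haveI : Finite (↥U ⧸ W.subgroupOf U) := Subgroup.quotient_finite_of_isOpen _ hW'
  letI : Fintype (↥U ⧸ W.subgroupOf U) := Fintype.ofFinite _
  have hcop' : ¬ p ∣ Fintype.card (↥U ⧸ W.subgroupOf U) := by rwa [Fintype.card_eq_nat_card]
  -- a basis of the `𝔽_p`-vector space `M`
  let bv : Module.Basis (Fin (Module.finrank (ZMod p) M)) (ZMod p) M := Module.finBasis (ZMod p) M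
  -- the objects of the generic computation on the compact group `↥U`
  have hWA := restrict_apply_eq_self_of_mem ρ₀ W U hWfix
  have hWM := inflate_restrict_apply_eq_self_of_mem W U σ
  let e : ZMod p ≃+ MuCarrier K p :=
    (ZMod.ringEquivCongr (natCard_muCarrier (K := K) p).symm).toAddEquiv.trans
      (zmodAddCyclicAddEquiv (isAddCyclic_of_prime_card (natCard_muCarrier (K := K) p)))
  let σ' := (ρ₀.restrict (subgroupIncl U)).untwistRep
    (((ContinuousRep.ofDiscrete σ).restrict (ContinuousMonoidHom.quotientMk W)).restrict (subgroupIncl U))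
    (W.subgroupOf U) e hWA hWM
  let a := MatrixTwist.coordMatrix σ' bv
  have hpA : ∀ v : MuCarrier K p, (p : ℤ) • v = 0 := fun v => ContinuousRep.zsmul_natCast_eq_zero_of_addEquiv e v
  have ha1 : ∀ x : Fin (Module.finrank (ZMod p) M) → MuCarrier K p, ContinuousRep.matAct (a 1) x = x :=
    fun x => MatrixTwist.sum_coordMatrix_one σ' bv x
  have hamul : ∀ (c c' : ↥U ⧸ W.subgroupOf U) (x : Fin (Module.finrank (ZMod p) M) → MuCarrier K p),
      ContinuousRep.matAct (a (c * c')) x = ContinuousRep.matAct (a c) (ContinuousRep.matAct (a c') x) :=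
    fun c c' x => MatrixTwist.sum_coordMatrix_mul σ' bv hpA c c' x
  have hσ : ∀ c j, σ' c (bv j) = ∑ i, a c i j • bv i := fun c j => MatrixTwist.coordMatrix_spec σ' bv c j
  -- the equivariant identity read at `ψ := v_p #(fixed vectors)`
  have key := hB6b (fun X _ _ τX => (padicValNat p (Nat.card {h : Fin (Module.finrank (ZMod p) M) → X //
      ∀ c : ↥U ⧸ W.subgroupOf U, (fun i => ∑ j, a c i j • τX c (h j)) = h}) : ℤ))
    (MatrixTwist.additive_padicValNat_fixedVectors a hcop'
      (fun X _ _ _ => MatrixTwist.sum_coordMatrix_one σ' bv)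
      (fun X _ _ hX => MatrixTwist.sum_coordMatrix_mul σ' bv hX))
  have hreg := MatrixTwist.natCard_fixedVectors_permQuot σ' bv
  have hMd : Nat.card M = p ^ Module.finrank (ZMod p) M := (ContinuousRep.natCard_eq_pow_of_basis e bv).1
  rw [hreg, hMd, padicValNat.prime_pow, nsmul_eq_mul] at key
  have hEuler : padicValNat p (Nat.card {h : Fin (Module.finrank (ZMod p) M) →
        continuousCohomology 0 ((ρ₀.restrict (subgroupIncl U)).coindOpen (W.subgroupOf U) hW').toTopRep //
        ∀ c : ↥U ⧸ W.subgroupOf U, (fun i => ∑ j, a c i j •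
          (ρ₀.restrict (subgroupIncl U)).coindOpenHRep (W.subgroupOf U) hW' 0 c (h j)) = h}) +
      padicValNat p (Nat.card {h : Fin (Module.finrank (ZMod p) M) →
        continuousCohomology 2 ((ρ₀.restrict (subgroupIncl U)).coindOpen (W.subgroupOf U) hW').toTopRep //
        ∀ c : ↥U ⧸ W.subgroupOf U, (fun i => ∑ j, a c i j •
          (ρ₀.restrict (subgroupIncl U)).coindOpenHRep (W.subgroupOf U) hW' 2 c (h j)) = h}) +
      r * Module.finrank (ZMod p) M =
      padicValNat p (Nat.card {h : Fin (Module.finrank (ZMod p) M) →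
        continuousCohomology 1 ((ρ₀.restrict (subgroupIncl U)).coindOpen (W.subgroupOf U) hW').toTopRep //
        ∀ c : ↥U ⧸ W.subgroupOf U, (fun i => ∑ j, a c i j •
          (ρ₀.restrict (subgroupIncl U)).coindOpenHRep (W.subgroupOf U) hW' 1 c (h j)) = h}) := by
    exact_mod_cast key
  exact (ρ₀.restrict (subgroupIncl U)).euler_characteristic_of_fixedCount
    (((ContinuousRep.ofDiscrete σ).restrict (ContinuousMonoidHom.quotientMk W)).restrict (subgroupIncl U))
    (W.subgroupOf U) hW' e bv hWA hWM a ha1 hamul hσ hcop' r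
    (finite_continuousCohomology_coindOpen_subgroupOf_mu S hS p hSp ρ₀ hρ₀ W U hWU hWo hWfix hW' 0 (by omega))
    (finite_continuousCohomology_coindOpen_subgroupOf_mu S hS p hSp ρ₀ hρ₀ W U hWU hWo hWfix hW' 1 (by omega))
    (finite_continuousCohomology_coindOpen_subgroupOf_mu S hS p hSp ρ₀ hρ₀ W U hWU hWo hWfix hW' 2 le_rfl)
    hEuler

/-- **The same with the `p`-torsion hypothesis `pM = 0` of `hbase`** (the `𝔽_p`-structure on `M` is
`AddCommGroup.zmodModule`).  This is, token for token, one instance of the hypothesis `hbase` of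
`tateGlobalEulerPoincareCharacteristic_of_isTotallyComplex_of_base` (with `U = π⁻¹(C)`,
`r = [G_S : U] · r₂(K)`), from the equivariant identity `hB6b`.
[cite: MilneADT2006, I Thm. 5.1 (proof)] [cite: NeukirchSchmidtWingberg2008, (8.7.4)] -/
theorem euler_restrict_of_coindMuEuler [IsTotallyComplex K]
    (S : Set (HeightOneSpectrum (𝓞 K))) (hS : S.Finite) (p : ℕ) [Fact p.Prime]
    (hSp : ∀ v : HeightOneSpectrum (𝓞 K), ((p : ℕ) : 𝓞 K) ∈ v.asIdeal → v ∈ S)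
    (ρ₀ : ContinuousRep (GaloisGroupUnramifiedOutside K S) ℤ (MuCarrier K p))
    (hρ₀ : ∀ (τ : absoluteGaloisGroup K) (v : MuCarrier K p), ρ₀ (toUnramifiedQuot K S τ) v = mu K p τ v)
    (W U : Subgroup (GaloisGroupUnramifiedOutside K S)) [W.Normal] [DiscreteTopology (GaloisGroupUnramifiedOutside K S ⧸ W)]
    (hWU : W ≤ U) (hWo : IsOpen (W : Set (GaloisGroupUnramifiedOutside K S)))
    (hWfix : ∀ g ∈ W, ∀ v : MuCarrier K p, ρ₀ g v = v) [CompactSpace ↥U]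
    (hW' : IsOpen ((W.subgroupOf U : Subgroup ↥U) : Set ↥U))
    (hcop : ¬ p ∣ Nat.card (↥U ⧸ W.subgroupOf U))
    (M : Type) [AddCommGroup M] [TopologicalSpace M] [DiscreteTopology M] [Finite M]
    (σ : Representation ℤ (GaloisGroupUnramifiedOutside K S ⧸ W) M) (hM : ∀ m : M, (p : ℤ) • m = 0) (r : ℕ)
    (hB6b : ∀ (ψ : ∀ ⦃X : Type⦄ [AddCommGroup X] [Module ℤ X],
        Representation ℤ (↥U ⧸ W.subgroupOf U) X → ℤ),
      (∀ ⦃X Y Z : Type⦄ [AddCommGroup X] [Module ℤ X] [AddCommGroup Y] [Module ℤ Y]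
        [AddCommGroup Z] [Module ℤ Z] (ρX : Representation ℤ (↥U ⧸ W.subgroupOf U) X)
        (ρY : Representation ℤ (↥U ⧸ W.subgroupOf U) Y) (ρZ : Representation ℤ (↥U ⧸ W.subgroupOf U) Z)
        (f : X →ₗ[ℤ] Y) (g : Y →ₗ[ℤ] Z),
        (∀ s x, f (ρX s x) = ρY s (f x)) → (∀ s y, g (ρY s y) = ρZ s (g y)) →
        Injective f → Surjective g → LinearMap.range f = LinearMap.ker g → Finite Y →
        (∀ y : Y, (p : ℤ) • y = 0) → ψ ρY = ψ ρX + ψ ρZ) →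
      ψ ((ρ₀.restrict (subgroupIncl U)).coindOpenHRep (W.subgroupOf U) hW' 0) +
          ψ ((ρ₀.restrict (subgroupIncl U)).coindOpenHRep (W.subgroupOf U) hW' 2) +
          r • ψ ((Representation.ofMulAction ℤ (↥U ⧸ W.subgroupOf U) (↥U ⧸ W.subgroupOf U)).quotient
            ((p : ℤ) • ⊤) (StableLatticeReduction.smul_top_le_comap _ (p : ℤ))) =
        ψ ((ρ₀.restrict (subgroupIncl U)).coindOpenHRep (W.subgroupOf U) hW' 1)) :
    ((padicValNat p (Nat.card (continuousCohomology 0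
        (((ContinuousRep.ofDiscrete σ).restrict (ContinuousMonoidHom.quotientMk W)).restrict
          (subgroupIncl U)).toTopRep)) : ℤ) -
        padicValNat p (Nat.card (continuousCohomology 1
          (((ContinuousRep.ofDiscrete σ).restrict (ContinuousMonoidHom.quotientMk W)).restrict
            (subgroupIncl U)).toTopRep)) +
        padicValNat p (Nat.card (continuousCohomology 2
          (((ContinuousRep.ofDiscrete σ).restrict (ContinuousMonoidHom.quotientMk W)).restrict
            (subgroupIncl U)).toTopRep)) +
      (r : ℕ) * padicValNat p (Nat.card M)) = 0 := by
  letI : Module (ZMod p) M := AddCommGroup.zmodModule fun m => by rw [← natCast_zsmul]; exact hM m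
  exact euler_restrict_of_coindMuEuler_of_module S hS p hSp ρ₀ hρ₀ W U hWU hWo hWfix hW' hcop M σ r hB6b

/-- **`hbase` for `U = π⁻¹(C)`, `C ≤ G_S ⧸ W` of order prime to `p`** (the binders of
`tateGlobalEulerPoincareCharacteristic_of_isTotallyComplex_of_base`, cyclicity of `C` not needed),
from the equivariant identity `hB6b` with `r = [G_S : U] · r₂(K)`; the instance `CompactSpace ↥U` is
`compactSpace_subgroup_of_isOpen`, the openness `hW'` is `hWo.preimage continuous_subtype_val`.
[cite: MilneADT2006, I Thm. 5.1 (proof)] [cite: NeukirchSchmidtWingberg2008, (8.7.4)] -/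
theorem baseK_of_coindMuEuler [IsTotallyComplex K]
    (S : Set (HeightOneSpectrum (𝓞 K))) (hS : S.Finite) (p : ℕ) [Fact p.Prime]
    (hSp : ∀ v : HeightOneSpectrum (𝓞 K), ((p : ℕ) : 𝓞 K) ∈ v.asIdeal → v ∈ S)
    (ρ₀ : ContinuousRep (GaloisGroupUnramifiedOutside K S) ℤ (MuCarrier K p))
    (hρ₀ : ∀ (τ : absoluteGaloisGroup K) (v : MuCarrier K p), ρ₀ (toUnramifiedQuot K S τ) v = mu K p τ v)
    (W : Subgroup (GaloisGroupUnramifiedOutside K S)) [W.Normal]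
    [DiscreteTopology (GaloisGroupUnramifiedOutside K S ⧸ W)]
    (hWo : IsOpen (W : Set (GaloisGroupUnramifiedOutside K S)))
    (hWfix : ∀ g ∈ W, ∀ v : MuCarrier K p, ρ₀ g v = v)
    (C : Subgroup (GaloisGroupUnramifiedOutside K S ⧸ W)) (hC : (Nat.card C).Coprime p)
    (M : Type) [AddCommGroup M] [TopologicalSpace M] [DiscreteTopology M] [Finite M]
    (σ : Representation ℤ (GaloisGroupUnramifiedOutside K S ⧸ W) M) (hM : ∀ m : M, (p : ℤ) • m = 0)
    [CompactSpace ↥(C.comap (QuotientGroup.mk' W))]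
    (hW' : IsOpen ((W.subgroupOf (C.comap (QuotientGroup.mk' W)) :
      Subgroup ↥(C.comap (QuotientGroup.mk' W))) : Set ↥(C.comap (QuotientGroup.mk' W))))
    (hB6b : ∀ (ψ : ∀ ⦃X : Type⦄ [AddCommGroup X] [Module ℤ X],
        Representation ℤ (↥(C.comap (QuotientGroup.mk' W)) ⧸ W.subgroupOf (C.comap (QuotientGroup.mk' W))) X → ℤ),
      (∀ ⦃X Y Z : Type⦄ [AddCommGroup X] [Module ℤ X] [AddCommGroup Y] [Module ℤ Y]
        [AddCommGroup Z] [Module ℤ Z]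
        (ρX : Representation ℤ (↥(C.comap (QuotientGroup.mk' W)) ⧸ W.subgroupOf (C.comap (QuotientGroup.mk' W))) X)
        (ρY : Representation ℤ (↥(C.comap (QuotientGroup.mk' W)) ⧸ W.subgroupOf (C.comap (QuotientGroup.mk' W))) Y)
        (ρZ : Representation ℤ (↥(C.comap (QuotientGroup.mk' W)) ⧸ W.subgroupOf (C.comap (QuotientGroup.mk' W))) Z)
        (f : X →ₗ[ℤ] Y) (g : Y →ₗ[ℤ] Z),
        (∀ s x, f (ρX s x) = ρY s (f x)) → (∀ s y, g (ρY s y) = ρZ s (g y)) →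
        Injective f → Surjective g → LinearMap.range f = LinearMap.ker g → Finite Y →
        (∀ y : Y, (p : ℤ) • y = 0) → ψ ρY = ψ ρX + ψ ρZ) →
      ψ ((ρ₀.restrict (subgroupIncl (C.comap (QuotientGroup.mk' W)))).coindOpenHRep
            (W.subgroupOf (C.comap (QuotientGroup.mk' W))) hW' 0) +
          ψ ((ρ₀.restrict (subgroupIncl (C.comap (QuotientGroup.mk' W)))).coindOpenHRep
            (W.subgroupOf (C.comap (QuotientGroup.mk' W))) hW' 2) +
          ((C.comap (QuotientGroup.mk' W)).index * InfinitePlace.nrComplexPlaces K) •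
            ψ ((Representation.ofMulAction ℤ
              (↥(C.comap (QuotientGroup.mk' W)) ⧸ W.subgroupOf (C.comap (QuotientGroup.mk' W)))
              (↥(C.comap (QuotientGroup.mk' W)) ⧸ W.subgroupOf (C.comap (QuotientGroup.mk' W)))).quotient
              ((p : ℤ) • ⊤) (StableLatticeReduction.smul_top_le_comap _ (p : ℤ))) =
        ψ ((ρ₀.restrict (subgroupIncl (C.comap (QuotientGroup.mk' W)))).coindOpenHRep
            (W.subgroupOf (C.comap (QuotientGroup.mk' W))) hW' 1)) :
    ((padicValNat p (Nat.card (continuousCohomology 0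
        (((ContinuousRep.ofDiscrete σ).restrict (ContinuousMonoidHom.quotientMk W)).restrict
          (subgroupIncl (C.comap (QuotientGroup.mk' W)))).toTopRep)) : ℤ) -
        padicValNat p (Nat.card (continuousCohomology 1
          (((ContinuousRep.ofDiscrete σ).restrict (ContinuousMonoidHom.quotientMk W)).restrict
            (subgroupIncl (C.comap (QuotientGroup.mk' W)))).toTopRep)) +
        padicValNat p (Nat.card (continuousCohomology 2
          (((ContinuousRep.ofDiscrete σ).restrict (ContinuousMonoidHom.quotientMk W)).restrict
            (subgroupIncl (C.comap (QuotientGroup.mk' W)))).toTopRep)) +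
      ((C.comap (QuotientGroup.mk' W)).index * InfinitePlace.nrComplexPlaces K : ℕ) *
        padicValNat p (Nat.card M)) = 0 :=
  euler_restrict_of_coindMuEuler S hS p hSp ρ₀ hρ₀ W (C.comap (QuotientGroup.mk' W)) (le_comap_mk' W C) hWo
    hWfix hW' (by
      rw [natCard_quotient_subgroupOf_comap W C]
      exact fun h => (Fact.out : p.Prime).ne_one (Nat.eq_one_of_dvd_coprimes hC h dvd_rfl))
    M σ hM _ hB6b

end Literature.NumberTheory.GaloisCohomology

end
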